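import Mathlib.LinearAlgebra.Quotient.Basic
import Mathlib.LinearAlgebra.Dimension.Constructions
import Mathlib.LinearAlgebra.FiniteDimensional.Lemmas
import Mathlib.Algebra.Algebra.Basic
import HarnessLib

/-!
# Two splitting criteria for a short exact sequence of modules over an algebra:
# a sign endomorphism (`+1` on the sub, `−1` on the quotient) and a Hom-dimension count

Topic `Algebra/Module`; namespace `Literature.Algebra.Module.ExtensionSplitting`.  THEOREMS ONLY (no definition, no instance, no named
fact, no `sorry`), Mathlib-only imports.  `R` is a (possibly non-commutative) `k`-algebra and all modules are `R`-modules with the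
compatible `k`-structure (`IsScalarTower k R ·`) — the case of interest is `R = ` a group algebra ∕ Hecke algebra over `k = ℂ`, the modules
smooth representations, the sequence `0 → π → E → π′ → 0` an extension of representations.

* §1 SIGN-SPLIT.  `0 → A —ι→ M —p→ A′ → 0` exact (`ι` need not be injective for the statement), `2` invertible in `k`, and `φ ∈ End_R(M)`
  with `φ ∘ ι = ι` and `p ∘ φ = −p`.  Then `p` has an `R`-linear section: `ψ := ½(1 − φ)` kills `ι(A) = ker p` and satisfies `p ∘ ψ = p`,
  so it descends to `s : A′ → M` with `p ∘ s = 1`.  (Equivalently: the class of the extension equals its own negative.)  This is the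
  algebraic step that turns «the normalised intertwining operator acts by opposite signs on the two copies of `π⁺`» into
  `Ext¹(π⁺, π⁺) = 0` for the members of a reducible unitary principal series of a rank-one group [Keys1984, §3] — the l.d.s. case of
  [Rogawski1990, §12.2 (3); Prop. 12.6.1 (c)].
* §2 HOM-COUNT-SPLIT.  `k` a field, `0 → L —ι→ E —p→ L′ → 0` exact with `ι` injective and `p` surjective, `Hom_R(L′, L)` and
  `End_R(L)` finite-dimensional over `k` with `dim_k Hom_R(E, L) ≥ dim_k Hom_R(L′, L) + dim_k End_R(L)` (for `L′ ≅ L` simple with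
  `End = k`: `dim Hom_R(E, L) ≥ 2`).  Then `ι` has an `R`-linear retraction (so the sequence splits).  Proof: restriction
  `f ↦ f ∘ ι : Hom_R(E,L) → End_R(L)` has kernel `≅ Hom_R(L′, L)` (factor through `p`), so the count forces surjectivity and `1_L` is
  hit.  This is the device «`dim End_G i_B(χ) = 2` ⇒ `r_B i_B χ ≅ χ ⊕ χ`» ∕ «a second eigenfunctional ⇒ reducible» of the same theory
  [BernsteinZelevinsky1976, Prop. 2.28] [Keys1984, §3].

## References
* [Keys1984] D. Keys, *Principal series representations of special unitary groups over local fields*, Compositio Math. 51 (1984), §3.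
* [Rogawski1990] J. D. Rogawski, *Automorphic Representations of Unitary Groups in Three Variables* (1990), §12.2 (3), §12.6 Prop. 12.6.1.
* [BernsteinZelevinsky1976] I. N. Bernstein, A. V. Zelevinsky, Russian Math. Surveys 31:3 (1976), Prop. 2.28.
-/

set_option autoImplicit false

namespace Literature.Algebra.Module.ExtensionSplitting

/-! ## §1 SIGN-SPLIT -/

section SignSplit

variable {k R : Type*} [CommRing k] [Ring R] [Algebra k R]
  {A M A' : Type*} [AddCommGroup A] [Module R A] [AddCommGroup M] [Module R M] [Module k M] [IsScalarTower k R M]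
  [AddCommGroup A'] [Module R A'] [Module k A'] [IsScalarTower k R A']

/-- **SIGN-SPLIT, endomorphism form.**  If `p ∘ ι = 0`, `ker p ≤ range ι`, `2` is invertible in `k`, and `φ ∈ End_R(M)` fixes `ι(A)` pointwise
(`φ ∘ ι = ι`) while acting by `−1` modulo it (`p ∘ φ = −p`), then `ψ := ⅟2 • (1 − φ)` satisfies `ψ ∘ ι = 0` and `p ∘ ψ = p`.
[cite: Keys1984, §3] -/
theorem half_one_sub_comp (h2 : Invertible (2 : k)) (ι : A →ₗ[R] M) (p : M →ₗ[R] A') (φ : M →ₗ[R] M)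
    (hφι : φ ∘ₗ ι = ι) (hφp : p ∘ₗ φ = -p) :
    ((⅟(2 : k)) • (LinearMap.id - φ)) ∘ₗ ι = 0 ∧ p ∘ₗ ((⅟(2 : k)) • (LinearMap.id - φ)) = p := by
  constructor
  · rw [LinearMap.smul_comp, LinearMap.sub_comp, LinearMap.id_comp, hφι, sub_self, smul_zero]
  · rw [LinearMap.comp_smul, LinearMap.comp_sub, LinearMap.comp_id, hφp, sub_neg_eq_add, ← two_smul k p, smul_smul,
      invOf_mul_self, one_smul]

/-- **SIGN-SPLIT.**  Let `A —ι→ M —p→ A′` be `R`-linear with `p` surjective and `ker p = range ι` (a short exact sequence on the right), over a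
`k`-algebra `R` with `2` invertible in `k`.  If some `φ ∈ End_R(M)` satisfies `φ ∘ ι = ι` and `p ∘ φ = −p`, then `p` admits an `R`-linear
section — the extension SPLITS.  (The extension is isomorphic, via `φ`, to its pull-back along `−1`, so its class `e` satisfies `e = −e`.)
[cite: Keys1984, §3] [cite: Rogawski1990, §12.6 Prop. 12.6.1 (c)] -/
theorem exists_section_of_sign_endomorphism (h2 : Invertible (2 : k)) (ι : A →ₗ[R] M) (p : M →ₗ[R] A')
    (hp : Function.Surjective p) (hexact : LinearMap.ker p = LinearMap.range ι) (φ : M →ₗ[R] M)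
    (hφι : φ ∘ₗ ι = ι) (hφp : p ∘ₗ φ = -p) :
    ∃ s : A' →ₗ[R] M, p ∘ₗ s = LinearMap.id := by
  obtain ⟨hψι, hpψ⟩ := half_one_sub_comp h2 ι p φ hφι hφp
  set ψ : M →ₗ[R] M := (⅟(2 : k)) • (LinearMap.id - φ) with hψ
  -- `ψ` kills `ker p = range ι`, so it factors through the quotient `M ⧸ ker p ≃ A′`
  have hker : LinearMap.ker p ≤ LinearMap.ker ψ := by
    rw [hexact]
    rintro x ⟨a, rfl⟩
    rw [LinearMap.mem_ker, ← LinearMap.comp_apply, hψι, LinearMap.zero_apply]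
  refine ⟨((LinearMap.ker p).liftQ ψ hker) ∘ₗ (p.quotKerEquivOfSurjective hp).symm.toLinearMap, ?_⟩
  apply LinearMap.ext
  intro a'
  obtain ⟨m, rfl⟩ := hp a'
  have hsymm : (p.quotKerEquivOfSurjective hp).symm (p m) = Submodule.Quotient.mk m := by
    rw [LinearEquiv.symm_apply_eq]; rfl
  rw [LinearMap.comp_apply, LinearMap.comp_apply, LinearEquiv.coe_toLinearMap, hsymm, Submodule.liftQ_apply,
    ← LinearMap.comp_apply, hpψ, LinearMap.id_apply]

end SignSplit

/-! ## §2 HOM-COUNT-SPLIT -/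

section HomCount

variable {k R : Type*} [Field k] [Ring R] [Algebra k R]
  {L E L' : Type*} [AddCommGroup L] [Module R L] [Module k L] [IsScalarTower k R L]
  [AddCommGroup E] [Module R E] [AddCommGroup L'] [Module R L']

/-- Restriction along `ι` as a `k`-linear map `Hom_R(E, L) → Hom_R(A, L)`, `f ↦ f ∘ ι` — its kernel consists of the maps vanishing on
`range ι`. [cite: BernsteinZelevinsky1976, Proposition 2.28] -/
theorem mem_ker_lcomp_iff {A : Type*} [AddCommGroup A] [Module R A] (ι : A →ₗ[R] E) (f : E →ₗ[R] L) :
    f ∘ₗ ι = 0 ↔ LinearMap.range ι ≤ LinearMap.ker f := by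
  rw [LinearMap.range_le_ker_iff]

/-- **HOM-COUNT-SPLIT.**  Let `L —ι→ E —p→ L′` be `R`-linear over a `k`-algebra `R` (`k` a field), with `p` surjective and `ker p = range ι`.
Suppose `Hom_R(E, L)` is finite-dimensional over `k` and `dim_k Hom_R(E, L) ≥ dim_k Hom_R(L′, L) + dim_k End_R(L)` — e.g. `L′ ≃ L` simple with
`End_R(L) = k` and `dim_k Hom_R(E, L) ≥ 2`.  Then `ι` has an `R`-linear retraction `r` (`r ∘ ι = 1_L`), so the sequence splits.  Proof: the
restriction `f ↦ f ∘ ι` has kernel the maps factoring through `p`, of dimension `≤ dim Hom_R(L′, L)`, so its image has dimension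
`≥ dim End_R(L)`, i.e. it is onto. [cite: BernsteinZelevinsky1976, Proposition 2.28] [cite: Keys1984, §3] -/
theorem exists_retraction_of_finrank_hom_le (ι : L →ₗ[R] E) (p : E →ₗ[R] L') (hp : Function.Surjective p)
    (hexact : LinearMap.ker p = LinearMap.range ι)
    [FiniteDimensional k (E →ₗ[R] L)] [FiniteDimensional k (L' →ₗ[R] L)] [FiniteDimensional k (L →ₗ[R] L)]
    (hdim : Module.finrank k (L' →ₗ[R] L) + Module.finrank k (L →ₗ[R] L) ≤ Module.finrank k (E →ₗ[R] L)) :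
    ∃ r : E →ₗ[R] L, r ∘ₗ ι = LinearMap.id := by
  -- the restriction map `res : Hom_R(E, L) → End_R(L)`, `k`-linear
  let res : (E →ₗ[R] L) →ₗ[k] (L →ₗ[R] L) :=
    { toFun := fun f => f ∘ₗ ι
      map_add' := fun f g => LinearMap.add_comp _ _ _
      map_smul' := fun c f => LinearMap.smul_comp _ _ _ }
  -- the factorisation map `fac : Hom_R(L′, L) → Hom_R(E, L)`, `g ↦ g ∘ p`, `k`-linear, surjects onto `ker res`
  let fac : (L' →ₗ[R] L) →ₗ[k] (E →ₗ[R] L) :=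
    { toFun := fun g => g ∘ₗ p
      map_add' := fun f g => LinearMap.add_comp _ _ _
      map_smul' := fun c f => LinearMap.smul_comp _ _ _ }
  have hker : LinearMap.ker res ≤ LinearMap.range fac := by
    intro f hf
    rw [LinearMap.mem_ker] at hf
    -- `f ∘ ι = 0`, so `f` kills `range ι = ker p` and factors through `p`
    have hle : LinearMap.ker p ≤ LinearMap.ker f := by
      rw [hexact, LinearMap.range_le_ker_iff]; exact hf
    refine ⟨((LinearMap.ker p).liftQ f hle) ∘ₗ (p.quotKerEquivOfSurjective hp).symm.toLinearMap, ?_⟩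
    apply LinearMap.ext
    intro e
    have hsymm : (p.quotKerEquivOfSurjective hp).symm (p e) = Submodule.Quotient.mk e := by
      rw [LinearEquiv.symm_apply_eq]; rfl
    change (((LinearMap.ker p).liftQ f hle) ∘ₗ (p.quotKerEquivOfSurjective hp).symm.toLinearMap) (p e) = f e
    rw [LinearMap.comp_apply, LinearEquiv.coe_toLinearMap, hsymm, Submodule.liftQ_apply]
  -- dimension count: `dim ker res ≤ dim Hom(L′, L)`, hence `dim range res ≥ dim End(L)`, so `res` is onto
  haveI : FiniteDimensional k (LinearMap.range fac) := Module.Finite.range fac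
  have hker_dim : Module.finrank k (LinearMap.ker res) ≤ Module.finrank k (L' →ₗ[R] L) :=
    (Submodule.finrank_mono hker).trans (LinearMap.finrank_range_le fac)
  have hrn := LinearMap.finrank_range_add_finrank_ker res
  have hrange : Module.finrank k (L →ₗ[R] L) ≤ Module.finrank k (LinearMap.range res) := by omega
  have hsurj : LinearMap.range res = ⊤ := Submodule.eq_top_of_finrank_eq
    (le_antisymm (Submodule.finrank_le _) hrange)
  have h1 : (LinearMap.id : L →ₗ[R] L) ∈ LinearMap.range res := hsurj ▸ Submodule.mem_top
  obtain ⟨r, hr⟩ := h1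
  exact ⟨r, hr⟩

/-- **HOM-COUNT-SPLIT, section form**: under the same hypotheses `p` has an `R`-linear section (the inverse of `p` on the kernel of a retraction of `ι`). [cite: BernsteinZelevinsky1976, Proposition 2.28] -/
theorem exists_section_of_finrank_hom_le (ι : L →ₗ[R] E) (p : E →ₗ[R] L')
    (hp : Function.Surjective p) (hexact : LinearMap.ker p = LinearMap.range ι)
    [FiniteDimensional k (E →ₗ[R] L)] [FiniteDimensional k (L' →ₗ[R] L)] [FiniteDimensional k (L →ₗ[R] L)]
    (hdim : Module.finrank k (L' →ₗ[R] L) + Module.finrank k (L →ₗ[R] L) ≤ Module.finrank k (E →ₗ[R] L)) :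
    ∃ s : L' →ₗ[R] E, p ∘ₗ s = LinearMap.id := by
  obtain ⟨r, hr⟩ := exists_retraction_of_finrank_hom_le ι p hp hexact hdim
  -- `p` restricted to `ker r` is an isomorphism onto `L′`; its inverse is the section
  have hinj : ∀ e ∈ LinearMap.ker r, p e = 0 → e = 0 := by
    intro e he hpe
    have he' : e ∈ LinearMap.range ι := hexact ▸ (LinearMap.mem_ker.2 hpe)
    obtain ⟨a, rfl⟩ := he'
    have : a = 0 := by
      have h := LinearMap.mem_ker.1 he
      rw [← LinearMap.comp_apply, hr, LinearMap.id_apply] at h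
      exact h
    rw [this, map_zero]
  have hsurj : ∀ l : L', ∃ e ∈ LinearMap.ker r, p e = l := by
    intro l
    obtain ⟨e, rfl⟩ := hp l
    refine ⟨e - ι (r e), ?_, ?_⟩
    · rw [LinearMap.mem_ker, map_sub, ← LinearMap.comp_apply, hr, LinearMap.id_apply, sub_self]
    · have : p (ι (r e)) = 0 := by
        have hm : ι (r e) ∈ LinearMap.ker p := hexact ▸ LinearMap.mem_range_self ι (r e)
        exact LinearMap.mem_ker.1 hm
      rw [map_sub, this, sub_zero]
  -- build the section on `ker r` via the bijection `p|_{ker r}`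
  let q : LinearMap.ker r →ₗ[R] L' := p ∘ₗ (LinearMap.ker r).subtype
  have hqb : Function.Bijective q := by
    refine ⟨fun x y hxy => ?_, fun l => ?_⟩
    · apply Subtype.ext
      have h := hinj (x.1 - y.1) (Submodule.sub_mem _ x.2 y.2) (by
        have : q x - q y = 0 := sub_eq_zero.2 hxy
        simpa [q, map_sub] using this)
      exact sub_eq_zero.1 h
    · obtain ⟨e, he, rfl⟩ := hsurj l
      exact ⟨⟨e, he⟩, rfl⟩
  let qe : LinearMap.ker r ≃ₗ[R] L' := LinearEquiv.ofBijective q hqb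
  refine ⟨(LinearMap.ker r).subtype ∘ₗ qe.symm.toLinearMap, ?_⟩
  apply LinearMap.ext
  intro l
  rw [LinearMap.comp_apply, LinearMap.comp_apply, LinearEquiv.coe_toLinearMap, LinearMap.id_apply]
  have : q (qe.symm l) = l := by
    change qe (qe.symm l) = l
    exact qe.apply_symm_apply l
  exact this

end HomCount

end Literature.Algebra.Module.ExtensionSplitting
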